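import Summits.BirchSwinnertonDyer.BirchSwinnertonDyer.Theorems.ResidualThetaTransportAtTwoSignedMuSeedAtTwoPlusGrasSaturation

/-!
# Prime ideals of `𝒪⟦X⟧`, finite index of gcd-free ideals, and freeness of rank-one lattices over `Λ′`

Route `ResidualThetaTransportAtTwo`, seed crux `SignedMuSeedAtTwoPlus` (stmt-BirchSwinnertonDyer-21438), line
card `gras-leopoldt-split` (k1 g16), stub **S1 `stub_splitting`**. The previous file
(`…GrasSaturation`, p662483) proved the structure statement «a rank-one lattice `E ≤ R²` whose cokernel
has no non-zero finite submodule is free, `E = R ∙ (g • e)` with `e` primitive» over an abstract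
Noetherian GCD domain `R`, modulo ONE ring-theoretic input `hdim`: every gcd-free proper ideal of `R`
has finite quotient. This file DISCHARGES that input (and the GCD structure) for the line's actual
coefficient rings `Λ′ = 𝒪⟦X⟧`, `𝒪` a local principal ideal domain with finite residue field
(`𝒪 = ℤ₂[ζ₃]` for the line; also `ℤ_p`, giving the classical `Λ = ℤ_p⟦T⟧`):

* `isPrincipal_or_eq_maximalIdeal_of_isPrime` — every prime ideal of `𝒪⟦X⟧` is principal or is the
  maximal ideal (Mathlib's 2025 structure theorems for primes of `R⟦X⟧`: a prime not containing `X` has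
  as many generators as its ideal of constant terms; a prime containing `X` is `(X) + C(its constant
  terms)`), i.e. «`Λ′` is a two-dimensional UFD» in the form the argument needs;
* `maximalIdeal_le_of_gcdFree` / `exists_maximalIdeal_pow_le_of_gcdFree` — a gcd-free proper ideal
  `J` (every common divisor of `J` is a unit) is `𝔪`-primary: `𝔪ⁿ ≤ J`;
* `finite_quotient_maximalIdeal` — `𝒪⟦X⟧/𝔪 ≅ 𝒪/𝔪_𝒪` is finite; `finite_quotient_of_gcdFree` —
  **`𝒪⟦X⟧/J` is finite** for every gcd-free proper `J` (= the input `hdim`);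
* `exists_generator_of_noFiniteSubmodule_powerSeries` / `nonempty_linearEquiv_of_noFiniteSubmodule_powerSeries`
  — **S1's structure statement over `Λ′` with no residual hypothesis on the ring**: a non-zero rank-one
  submodule `E ≤ Λ′²` such that `Λ′²/E` has no non-zero finite submodule is `Λ′ ∙ (g • e)` with
  `e` primitive (`IsRelPrime (e 0) (e 1)`), `g ≠ 0`, and `E ≃ₗ Λ′`.
* (appended) `finite_of_isTorsionBySet_gcdFree` / `finite_of_annihilator_gcdFree` — «pseudo-null ⟹
  finite»: a finitely generated `𝒪⟦X⟧`-module killed by a gcd-free (height-two) ideal is finite;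
  `eq_bot_of_noFiniteSubmodule_of_gcdFree` — the shape in which «no non-zero finite submodule» is consumed.
* (appended) `exists_linearEquiv_ideal_of_rankOne_powerSeries` — Rubin's form over `Λ′`, unconditional:
  a rank-one lattice in `Λ′²` is `≃` an ideal of FINITE index.
* (appended) `noFiniteSubmodule_of_injective` / `noFiniteSubmodule_submodule` — transport of «no non-zero
  finite submodule» along injections (`U′/Ē ↪ 𝔛`, `t𝔛 ≤ 𝔛`).

Nothing here proves BSD, the crux, the seed or (F); helper lemmas `--supports` the seed item; the
arithmetic objects of S1 (`U′^χ_∞ ≅ Λ′²`, `Ē^χ_∞`, «no finite submodule in `t𝔛(M_∞)`») are NOT constructed.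
[folklore] (Washington, *Cyclotomic Fields*, §13.2, Lemma 13.7 / Prop. 13.8 for the prime ideals of `Λ`;
NSW (5.3.x) «pseudo-null = finite» for `ℤ_p⟦T⟧`.)
-/

set_option autoImplicit false
set_option linter.dupNamespace false

namespace Summit.BirchSwinnertonDyer.BirchSwinnertonDyer.Theorems.SignedMuAtTwo.GrasLeopoldt

open PowerSeries IsLocalRing

variable {𝒪 : Type*} [CommRing 𝒪] [IsLocalRing 𝒪]

/-- Membership in the maximal ideal of `𝒪⟦X⟧` is read on the constant term. [folklore] -/
theorem mem_maximalIdeal_powerSeries_iff (f : 𝒪⟦X⟧) :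
    f ∈ maximalIdeal 𝒪⟦X⟧ ↔ constantCoeff f ∈ maximalIdeal 𝒪 := by
  rw [mem_maximalIdeal, mem_maximalIdeal, mem_nonunits_iff, mem_nonunits_iff,
    PowerSeries.isUnit_iff_constantCoeff]

variable [IsDomain 𝒪] [IsPrincipalIdealRing 𝒪]

/-- **Prime ideals of `𝒪⟦X⟧` (`𝒪` a local PID): principal or maximal.** Every prime ideal of `𝒪⟦X⟧`
is principal, or is the maximal ideal `𝔪 = (π, X)`. Proof: if `X ∉ P`, `P` has as many generators as
its (principal) ideal of constant terms (`PowerSeries.exist_eq_span_eq_ncard_of_X_notMem`); if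
`X ∈ P`, `P = (X, C a)` with `(a)` the ideal of constant terms (`eq_span_insert_X_of_X_mem_of_span_eq`),
which is prime, hence `0` (then `P = (X)`) or maximal (then `P = 𝔪`). [folklore] -/
theorem isPrincipal_or_eq_maximalIdeal_of_isPrime (P : Ideal 𝒪⟦X⟧) [hP : P.IsPrime] :
    (∃ p : 𝒪⟦X⟧, P = Ideal.span {p}) ∨ P = maximalIdeal 𝒪⟦X⟧ := by
  classical
  -- the ideal of constant terms is principal
  obtain ⟨a, ha⟩ := (IsPrincipalIdealRing.principal (P.map (constantCoeff (R := 𝒪)))).principal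
  have hSI : Ideal.span {a} = P.map constantCoeff := by rw [ha]
  by_cases hX : X ∈ P
  · -- `P = (X, C a)`
    have hPeq := eq_span_insert_X_of_X_mem_of_span_eq hX hSI
    rw [Set.image_singleton] at hPeq
    by_cases ha0 : a = 0
    · -- `P = (X)`
      left
      refine ⟨X, ?_⟩
      rw [hPeq, ha0, map_zero, Ideal.span_insert, Ideal.span_singleton_eq_bot.mpr rfl, sup_bot_eq]
    · -- the ideal of constant terms is a non-zero prime of the PID `𝒪`, hence maximal
      right
      have hker : RingHom.ker (constantCoeff (R := 𝒪)) ≤ P := by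
        intro f hf
        rw [RingHom.mem_ker] at hf
        obtain ⟨q, rfl⟩ := PowerSeries.X_dvd_iff.mpr hf
        exact P.mul_mem_right q hX
      haveI hprime : (P.map (constantCoeff (R := 𝒪))).IsPrime :=
        Ideal.map_isPrime_of_surjective constantCoeff_surj hker
      have hne : P.map (constantCoeff (R := 𝒪)) ≠ ⊥ := by
        rw [← hSI, Ne, Ideal.span_singleton_eq_bot]
        exact ha0
      have hmax : P.map (constantCoeff (R := 𝒪)) = maximalIdeal 𝒪 :=
        IsLocalRing.eq_maximalIdeal (IsPrime.to_maximal_ideal hne)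
      refine le_antisymm (IsLocalRing.le_maximalIdeal hP.ne_top) fun f hf => ?_
      rw [mem_maximalIdeal_powerSeries_iff, ← hmax,
        Ideal.mem_map_iff_of_surjective _ constantCoeff_surj] at hf
      obtain ⟨g, hgP, hg⟩ := hf
      have hfg : f - g ∈ P := hker (by rw [RingHom.mem_ker, map_sub, hg, sub_self])
      simpa using P.add_mem hfg hgP
  · -- `X ∉ P`: `P` is generated by one element
    left
    obtain ⟨T, hPT, -, hT⟩ :=
      exist_eq_span_eq_ncard_of_X_notMem hX hSI (Set.finite_singleton a)
    rw [Set.ncard_singleton] at hT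
    obtain ⟨p, rfl⟩ := Set.ncard_eq_one.mp hT
    exact ⟨p, hPT⟩

/-- **A gcd-free proper ideal of `𝒪⟦X⟧` is `𝔪`-primary.** If every common divisor of the elements of a
proper ideal `J` is a unit, then no principal prime contains `J`, so by
`isPrincipal_or_eq_maximalIdeal_of_isPrime` the maximal ideal is the only prime over `J`:
`𝔪 ≤ √J`. [folklore] -/
theorem maximalIdeal_le_radical_of_gcdFree (J : Ideal 𝒪⟦X⟧)
    (hJ : ∀ p : 𝒪⟦X⟧, (∀ j ∈ J, p ∣ j) → IsUnit p) : maximalIdeal 𝒪⟦X⟧ ≤ J.radical := by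
  rw [Ideal.radical_eq_sInf]
  refine le_sInf fun P hP => ?_
  obtain ⟨hJP, hPprime⟩ := hP
  haveI := hPprime
  rcases isPrincipal_or_eq_maximalIdeal_of_isPrime P with ⟨p, rfl⟩ | h
  · exfalso
    have hu : IsUnit p := hJ p fun j hj => Ideal.mem_span_singleton.mp (hJP hj)
    exact hPprime.ne_top (Ideal.span_singleton_eq_top.mpr hu)
  · exact h.ge

/-- **`𝔪ⁿ ≤ J` for a gcd-free proper ideal `J` of `𝒪⟦X⟧`** (Noetherian + `𝔪 ≤ √J`). [folklore] -/
theorem exists_maximalIdeal_pow_le_of_gcdFree (J : Ideal 𝒪⟦X⟧)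
    (hJ : ∀ p : 𝒪⟦X⟧, (∀ j ∈ J, p ∣ j) → IsUnit p) : ∃ n : ℕ, maximalIdeal 𝒪⟦X⟧ ^ n ≤ J :=
  Ideal.exists_pow_le_of_le_radical_of_fg (maximalIdeal_le_radical_of_gcdFree J hJ)
    (IsNoetherian.noetherian _)

omit [IsDomain 𝒪] [IsPrincipalIdealRing 𝒪] in
/-- **`𝒪⟦X⟧/𝔪` is finite** when the residue field of `𝒪` is: the constant-term map followed by
`𝒪 → 𝒪/𝔪_𝒪` is surjective with kernel `𝔪`. [folklore] -/
theorem finite_quotient_maximalIdeal_powerSeries [Finite (ResidueField 𝒪)] :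
    Finite (𝒪⟦X⟧ ⧸ maximalIdeal 𝒪⟦X⟧) := by
  let φ : 𝒪⟦X⟧ →+* ResidueField 𝒪 := (residue 𝒪).comp constantCoeff
  have hφ : Function.Surjective φ := residue_surjective.comp constantCoeff_surj
  have hker : RingHom.ker φ = maximalIdeal 𝒪⟦X⟧ := by
    ext f
    rw [RingHom.mem_ker, RingHom.comp_apply, residue_eq_zero_iff, mem_maximalIdeal_powerSeries_iff]
  have e : 𝒪⟦X⟧ ⧸ RingHom.ker φ ≃+* ResidueField 𝒪 := RingHom.quotientKerEquivOfSurjective hφ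
  rw [← hker]
  exact Finite.of_equiv _ e.toEquiv.symm

/-- **Finite index of gcd-free ideals (the input `hdim` of `exists_generator_of_noFiniteSubmodule`,
discharged for `Λ′ = 𝒪⟦X⟧`).** For `𝒪` a local PID with finite residue field, every proper ideal
`J ⊂ 𝒪⟦X⟧` all of whose common divisors are units has FINITE quotient `𝒪⟦X⟧/J`
(`𝔪ⁿ ≤ J` and `𝒪⟦X⟧/𝔪ⁿ` is finite). [folklore] -/
theorem finite_quotient_of_gcdFree [Finite (ResidueField 𝒪)] (J : Ideal 𝒪⟦X⟧)
    (hJ : ∀ p : 𝒪⟦X⟧, (∀ j ∈ J, p ∣ j) → IsUnit p) : Finite (𝒪⟦X⟧ ⧸ J) := by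
  obtain ⟨n, hn⟩ := exists_maximalIdeal_pow_le_of_gcdFree J hJ
  haveI := finite_quotient_maximalIdeal_powerSeries (𝒪 := 𝒪)
  haveI : Finite (𝒪⟦X⟧ ⧸ maximalIdeal 𝒪⟦X⟧ ^ n) :=
    Ideal.finite_quotient_pow (IsNoetherian.noetherian _) n
  exact Finite.of_surjective _ (Ideal.Quotient.factor_surjective hn)

/-- **S1's structure statement over `Λ′ = 𝒪⟦X⟧` (no residual ring hypothesis).** `𝒪` a local PID
with finite residue field (`ℤ₂[ζ₃]`, `ℤ_p`, …). A non-zero rank-one submodule `E ≤ Λ′²` (all elements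
commensurable with one vector `v`) such that `Λ′²/E` has NO non-zero finite submodule is cyclic on a
primitive vector: `E = Λ′ ∙ (g • e)`, `g ≠ 0`, `e 0, e 1` relatively prime. For the line:
`Ē^χ_∞ = Λ′·ge` inside `U′^χ_∞ ≅ Λ′²`, given «no finite submodule» (weak Leopoldt / `t𝔛(M_∞)`).
Uses the UFD structure of `𝒪⟦X⟧` (Mathlib) for the GCD monoid and `finite_quotient_of_gcdFree`. [folklore] -/
theorem exists_generator_of_noFiniteSubmodule_powerSeries [Finite (ResidueField 𝒪)]
    (E : Submodule 𝒪⟦X⟧ (Fin 2 → 𝒪⟦X⟧)) (v : Fin 2 → 𝒪⟦X⟧) (hv : v ≠ 0) (hvE : v ∈ E)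
    (hrank : ∀ x ∈ E, ∃ a b : 𝒪⟦X⟧, b ≠ 0 ∧ b • x = a • v)
    (hnf : ∀ Q : Submodule 𝒪⟦X⟧ ((Fin 2 → 𝒪⟦X⟧) ⧸ E), Finite Q → Q = ⊥) :
    ∃ (g : 𝒪⟦X⟧) (e : Fin 2 → 𝒪⟦X⟧), g ≠ 0 ∧ IsRelPrime (e 0) (e 1) ∧
      E = Submodule.span 𝒪⟦X⟧ {g • e} := by
  letI : GCDMonoid 𝒪⟦X⟧ := UniqueFactorizationMonoid.toGCDMonoid _
  have hdim : ∀ J : Ideal 𝒪⟦X⟧, J ≠ ⊤ → (∀ p : 𝒪⟦X⟧, (∀ j ∈ J, p ∣ j) → IsUnit p) →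
      Finite (𝒪⟦X⟧ ⧸ J) := fun J _ hJ => finite_quotient_of_gcdFree J hJ
  obtain ⟨g, e, hg, he, hE⟩ := exists_generator_of_noFiniteSubmodule hdim E v hv hvE hrank hnf
  exact ⟨g, e, hg, gcd_isUnit_iff_isRelPrime.mp he, hE⟩

/-- **Freeness over `Λ′ = 𝒪⟦X⟧`**: under the same hypotheses `E ≃ₗ[Λ′] Λ′` — «`Ē^χ_∞` is free of rank
one» with no residual hypothesis on the coefficient ring. [folklore] -/
theorem nonempty_linearEquiv_of_noFiniteSubmodule_powerSeries [Finite (ResidueField 𝒪)]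
    (E : Submodule 𝒪⟦X⟧ (Fin 2 → 𝒪⟦X⟧)) (v : Fin 2 → 𝒪⟦X⟧) (hv : v ≠ 0) (hvE : v ∈ E)
    (hrank : ∀ x ∈ E, ∃ a b : 𝒪⟦X⟧, b ≠ 0 ∧ b • x = a • v)
    (hnf : ∀ Q : Submodule 𝒪⟦X⟧ ((Fin 2 → 𝒪⟦X⟧) ⧸ E), Finite Q → Q = ⊥) :
    Nonempty (E ≃ₗ[𝒪⟦X⟧] 𝒪⟦X⟧) := by
  letI : GCDMonoid 𝒪⟦X⟧ := UniqueFactorizationMonoid.toGCDMonoid _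
  have hdim : ∀ J : Ideal 𝒪⟦X⟧, J ≠ ⊤ → (∀ p : 𝒪⟦X⟧, (∀ j ∈ J, p ∣ j) → IsUnit p) →
      Finite (𝒪⟦X⟧ ⧸ J) := fun J _ hJ => finite_quotient_of_gcdFree J hJ
  exact nonempty_linearEquiv_of_noFiniteSubmodule hdim E v hv hvE hrank hnf

/-! ### Pseudo-null `Λ′`-modules are finite (appended, same seat) -/

/-- **A finitely generated `𝒪⟦X⟧`-module killed by a gcd-free ideal is FINITE** («pseudo-null ⟹
finite» for `Λ′ = 𝒪⟦X⟧`, `𝒪` a local PID with finite residue field — e.g. `Λ = ℤ_p⟦T⟧`,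
`Λ′ = ℤ₂[ζ₃]⟦T⟧`): if `J` kills `M` and every common divisor of `J` is a unit (`J` has height `2`),
then `M` is a finitely generated module over the FINITE ring `𝒪⟦X⟧/J` (`finite_quotient_of_gcdFree`).
[folklore] (NSW, *Cohomology of Number Fields*, (5.3.19)(i) for `ℤ_p⟦T⟧`.) -/
theorem finite_of_isTorsionBySet_gcdFree [Finite (ResidueField 𝒪)] (M : Type*) [AddCommGroup M]
    [Module 𝒪⟦X⟧ M] [Module.Finite 𝒪⟦X⟧ M] (J : Ideal 𝒪⟦X⟧)
    (hJM : Module.IsTorsionBySet 𝒪⟦X⟧ M J)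
    (hJ : ∀ p : 𝒪⟦X⟧, (∀ j ∈ J, p ∣ j) → IsUnit p) : Finite M := by
  letI : Module (𝒪⟦X⟧ ⧸ J) M := hJM.module
  haveI : IsScalarTower 𝒪⟦X⟧ (𝒪⟦X⟧ ⧸ J) M := hJM.isScalarTower
  haveI : Module.Finite (𝒪⟦X⟧ ⧸ J) M :=
    Module.Finite.of_restrictScalars_finite 𝒪⟦X⟧ (𝒪⟦X⟧ ⧸ J) M
  haveI : Finite (𝒪⟦X⟧ ⧸ J) := finite_quotient_of_gcdFree J hJ
  exact Module.finite_of_finite (𝒪⟦X⟧ ⧸ J)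

/-- **Pseudo-null ⟹ finite, annihilator form**: a finitely generated `𝒪⟦X⟧`-module whose
annihilator is gcd-free (height `2`) is finite. [folklore] -/
theorem finite_of_annihilator_gcdFree [Finite (ResidueField 𝒪)] (M : Type*) [AddCommGroup M]
    [Module 𝒪⟦X⟧ M] [Module.Finite 𝒪⟦X⟧ M]
    (hM : ∀ p : 𝒪⟦X⟧, (∀ a ∈ Module.annihilator 𝒪⟦X⟧ M, p ∣ a) → IsUnit p) : Finite M :=
  finite_of_isTorsionBySet_gcdFree M (Module.annihilator 𝒪⟦X⟧ M)
    (fun x a => Module.mem_annihilator.mp a.2 x) hM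

/-- **How «no non-zero finite submodule» is consumed.** If the ambient `𝒪⟦X⟧`-module `M` has no
non-zero finite submodule, then every finitely generated submodule `N ≤ M` killed by a gcd-free ideal
is zero. (The shape used for `t𝔛(M_∞)` / `U′/Ē` on the line.) [folklore] -/
theorem eq_bot_of_noFiniteSubmodule_of_gcdFree [Finite (ResidueField 𝒪)] {M : Type*}
    [AddCommGroup M] [Module 𝒪⟦X⟧ M]
    (hnf : ∀ Q : Submodule 𝒪⟦X⟧ M, Finite Q → Q = ⊥)
    (N : Submodule 𝒪⟦X⟧ M) [Module.Finite 𝒪⟦X⟧ N] (J : Ideal 𝒪⟦X⟧)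
    (hJN : Module.IsTorsionBySet 𝒪⟦X⟧ N J)
    (hJ : ∀ p : 𝒪⟦X⟧, (∀ j ∈ J, p ∣ j) → IsUnit p) : N = ⊥ :=
  hnf N (finite_of_isTorsionBySet_gcdFree N J hJN hJ)

/-! ### Rubin's form over `Λ′` (appended, same seat) -/

/-- **A rank-one lattice in `Λ′²` is an ideal of finite index, unconditionally** (`Λ′ = 𝒪⟦X⟧`, `𝒪` a
local PID with finite residue field): `E ≃ J` with `Λ′/J` FINITE — the rank-two transposition of
«there is an injective homomorphism `θ : E_∞(χ) → Λ` with finite cokernel» (Lang, *Cyclotomic Fields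
I–II*, App. by Rubin, proof of Cor. 6.4). No hypothesis on finite submodules; with it, `J = ⊤`
(`nonempty_linearEquiv_of_noFiniteSubmodule_powerSeries`). [folklore] -/
theorem exists_linearEquiv_ideal_of_rankOne_powerSeries [Finite (ResidueField 𝒪)]
    (E : Submodule 𝒪⟦X⟧ (Fin 2 → 𝒪⟦X⟧)) (v : Fin 2 → 𝒪⟦X⟧) (hv : v ≠ 0) (hvE : v ∈ E)
    (hrank : ∀ x ∈ E, ∃ a b : 𝒪⟦X⟧, b ≠ 0 ∧ b • x = a • v) :
    ∃ J : Ideal 𝒪⟦X⟧, Finite (𝒪⟦X⟧ ⧸ J) ∧ Nonempty (E ≃ₗ[𝒪⟦X⟧] J) := by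
  letI : GCDMonoid 𝒪⟦X⟧ := UniqueFactorizationMonoid.toGCDMonoid _
  have hdim : ∀ J : Ideal 𝒪⟦X⟧, J ≠ ⊤ → (∀ p : 𝒪⟦X⟧, (∀ j ∈ J, p ∣ j) → IsUnit p) →
      Finite (𝒪⟦X⟧ ⧸ J) := fun J _ hJ => finite_quotient_of_gcdFree J hJ
  obtain ⟨J, -, hfin, hE⟩ := exists_linearEquiv_ideal_of_rankOne hdim E v hv hvE hrank
  exact ⟨J, hfin, hE⟩

/-! ### Transport of «no non-zero finite submodule» along injections (appended, same seat) -/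

/-- **«No non-zero finite submodule» pulls back along an injective linear map** (any ring): the shape
in which the line transports the weak-Leopoldt input from `𝔛(M_∞)` to `U′^χ_∞/Ē^χ_∞` through the
(injective) Artin map `U′/Ē ↪ 𝔛`. [folklore] -/
theorem noFiniteSubmodule_of_injective {R : Type*} [Ring R] {M N : Type*} [AddCommGroup M]
    [Module R M] [AddCommGroup N] [Module R N] (f : M →ₗ[R] N) (hf : Function.Injective f)
    (hN : ∀ Q : Submodule R N, Finite Q → Q = ⊥) :
    ∀ Q : Submodule R M, Finite Q → Q = ⊥ := by
  intro Q hQ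
  have hQN : Submodule.map f Q = ⊥ := by
    refine hN _ ?_
    haveI : Finite (Set.range (f.domRestrict Q)) := Set.finite_range _ |>.to_subtype
    have : (Submodule.map f Q : Set N) = Set.range (f.domRestrict Q) := by
      ext y
      simp [LinearMap.domRestrict_apply]
    exact Finite.of_equiv _ (Equiv.setCongr this).symm
  rw [eq_bot_iff]
  intro x hx
  have : f x ∈ Submodule.map f Q := Submodule.mem_map_of_mem hx
  rw [hQN, Submodule.mem_bot] at this
  exact (Submodule.mem_bot R).mpr (hf (by rw [this, map_zero]))

/-- **Finite submodules are torsion submodules**: «the torsion submodule `tN` has no non-zero finite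
submodule» already follows from (indeed is equivalent to) the same statement for `N`; this is the
direction the line uses (`t𝔛(M_∞)` ↦ `𝔛(M_∞)` needs nothing, and conversely every finite submodule of
`N` lies in `tN` when `R` is infinite — not needed here). [folklore] -/
theorem noFiniteSubmodule_submodule {R : Type*} [Ring R] {N : Type*} [AddCommGroup N] [Module R N]
    (hN : ∀ Q : Submodule R N, Finite Q → Q = ⊥) (T : Submodule R N) :
    ∀ Q : Submodule R T, Finite Q → Q = ⊥ :=
  noFiniteSubmodule_of_injective T.subtype Subtype.val_injective hN

end Summit.BirchSwinnertonDyer.BirchSwinnertonDyer.Theorems.SignedMuAtTwo.GrasLeopoldt
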